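import Literature.AlgebraicGeometry.Motives.IntegralModelReductionMapLifting
import HarnessLib

/-!
# Points of the generic fibre of a morphism of integral models over a point, as integral points over its extension
# ([SerreTate1968] §1; [Hartshorne1977] II.4.7; [Liu2002] §10.1.3)

Topic `Literature/AlgebraicGeometry/Motives`, namespace `Literature.AlgebraicGeometry.Motives.IntegralModel`.  THEOREMS only (no def, no instance,
no notation, no named fact, no `sorry`).  Cell `hodgecm-mathlib` (D-0151), FLOOR 0, programme F0P5a, crux item stmt-HodgeConjecture-24832 —
the first layer (G2)(G3) of the (S-γ2) dictionary «reduction of the generic geometric fibre of a finite cover» (F0P5a LEAD WORDS #11/#12,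
MOD-PLAN row L5.5a; desk `F0/P5a/S-gamma2-DESK.v0.F0P5a-p02g2.md` §2), in the D1 currency of ★ `IntegralModel.geomReductionMap`.

DATA: a number field `K`, a finite place `v`, `K`-schemes `T`, `X` with PROPER integral models `𝒯`, `𝒮` over `𝓞ᵥ`, an `𝓞ᵥ`-morphism
`π : 𝒯.total ⟶ 𝒮.total` with generic fibre `p : T ⟶ X` (`π_K ≫ e_𝒮 = e_𝒯 ≫ p`), the base `R = closureValuationSubring \overline{K_v} ⊆ Ω`,
and a point `x ∈ X(Ω)` with its integral extension `x̃ := extendPoint R f 𝒮.total (e_𝒮⁻¹ x) : Spec R → 𝒮` (valuative criterion, ★ `extendPoint`).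

* `extendPoint_symm_comp` — the extension of (the model point of) `y ∈ T(Ω)` followed by `π` is the extension of `p y`;
* **`bijective_extendPoint_fibre`** — `y ↦ ỹ := extendPoint (e_𝒯⁻¹ y)` is a BIJECTION from `{y ∈ T(Ω) | p y = x}` onto the `R`-points
  `ρ : Spec R → 𝒯` of the total space with `ρ ≫ π = x̃` (inverse: `ρ ↦ e_𝒯 (ρ|_{Spec Ω})`);
* `geomReductionMap_eq_reductionPoint_extendPoint` — under this bijection `red_𝒯 y = reductionPoint (ι_κ ≫ ỹ)` (★ `geomReductionMap_def`), and
  `π_v (red_𝒯 y) = red_𝒮 x` (★ C2a `geomReductionMap_map`);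
* **`ncard_fibre_geomReductionMap_eq`** — hence, for every `ȳ`, the number of `y` over `x` reducing to `ȳ` equals the number of `R`-points `ρ` of
  `𝒯` over `x̃` whose specialisation `ι_κ ≫ ρ` reduces to `ȳ` — the form in which the affine∕henselian layer (★ p798139, ★ p798065) counts them.

HC_CM is proved only modulo the 7 printed citations until rung 0 closes; this file is a generic leaf and changes no count.

## References
* [SerreTate1968] J.-P. Serre, J. Tate, *Good reduction of abelian varieties*, Ann. of Math. 88 (1968), §1 (the reduction map).
* [Hartshorne1977] R. Hartshorne, *Algebraic Geometry*, II.4.7 (valuative criterion of properness).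
* [Liu2002] Q. Liu, *Algebraic Geometry and Arithmetic Curves*, §10.1.3 (reduction of points, Cor. 10.1.38).
-/

set_option autoImplicit false

noncomputable section

open CategoryTheory AlgebraicGeometry IsDedekindDomain IsDedekindDomain.HeightOneSpectrum
open scoped NumberField
open Literature.NumberTheory.EllipticCurves (genericFibre)
open Literature.NumberTheory.GaloisRepresentations (closureValuationSubring)
open Literature.NumberTheory.DiophantineGeometry

namespace Literature.AlgebraicGeometry.Motives

namespace IntegralModel

variable {K : Type} [Field K] [NumberField K] {v : HeightOneSpectrum (𝓞 K)} {X T : SchemeOver K}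

/-- **Extension commutes with a model morphism**: for `y ∈ T(Ω)`, `extendPoint (e_𝒯⁻¹ y) ≫ π = extendPoint (e_𝒮⁻¹ (p y))` (★ `modelPointsEquiv_symm_map`,
★ `extendPoint_comp_hom`: uniqueness in the valuative criterion). [cite: Hartshorne1977, II.4.7] [cite: SerreTate1968, §1] -/
theorem extendPoint_symm_comp (𝒮 : IntegralModel (valuationSubringAtPrime K v) K X) (𝒯 : IntegralModel (valuationSubringAtPrime K v) K T)
    [IsProper 𝒮.total.hom] [IsProper 𝒯.total.hom] (π : 𝒯.total ⟶ 𝒮.total) (p : T ⟶ X)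
    (hπp : (genericFibre (valuationSubringAtPrime K v) K).map π ≫ 𝒮.genericIso'.hom = 𝒯.genericIso'.hom ≫ p)
    (y : AlgPoints T (AlgebraicClosure (v.adicCompletion K))) :
    extendPoint (closureValuationSubring (v.adicCompletion K)) (toClosureValuationSubring v) 𝒯.total (𝒯.modelPointsEquiv.symm y) ≫ π =
      extendPoint (closureValuationSubring (v.adicCompletion K)) (toClosureValuationSubring v) 𝒮.total
        (𝒮.modelPointsEquiv.symm (AlgPoints.map p y)) := by
  rw [modelPointsEquiv_symm_map 𝒯 𝒮 π p hπp, extendPoint_comp_hom]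

/-- Restriction to the generic point commutes with composition by a model morphism. [cite: Hartshorne1977, II.4.7] -/
theorem restrictPoint_comp (𝒮 : IntegralModel (valuationSubringAtPrime K v) K X) (𝒯 : IntegralModel (valuationSubringAtPrime K v) K T)
    (π : 𝒯.total ⟶ 𝒮.total)
    (ρ : specValuationSubring (closureValuationSubring (v.adicCompletion K)) (toClosureValuationSubring v) ⟶ 𝒯.total) :
    restrictPoint (closureValuationSubring (v.adicCompletion K)) (toClosureValuationSubring v) 𝒮.total (ρ ≫ π) =
      restrictPoint (closureValuationSubring (v.adicCompletion K)) (toClosureValuationSubring v) 𝒯.total ρ ≫ π :=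
  (Category.assoc _ _ _).symm

/-- **The points of the generic fibre over `x` are the integral points over `x̃`**: `y ↦ extendPoint (e_𝒯⁻¹ y)` is a bijection from
`{y ∈ T(Ω) | p y = x}` onto `{ρ : Spec R → 𝒯 | ρ ≫ π = x̃}`, `x̃ = extendPoint (e_𝒮⁻¹ x)` (valuative criterion for the proper `𝒯`; inverse
`ρ ↦ e_𝒯 (ρ|_{Spec Ω})`). [cite: Hartshorne1977, II.4.7] [cite: Liu2002, §10.1.3] -/
theorem bijective_extendPoint_fibre (𝒮 : IntegralModel (valuationSubringAtPrime K v) K X) (𝒯 : IntegralModel (valuationSubringAtPrime K v) K T)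
    [IsProper 𝒮.total.hom] [IsProper 𝒯.total.hom] (π : 𝒯.total ⟶ 𝒮.total) (p : T ⟶ X)
    (hπp : (genericFibre (valuationSubringAtPrime K v) K).map π ≫ 𝒮.genericIso'.hom = 𝒯.genericIso'.hom ≫ p)
    (x : AlgPoints X (AlgebraicClosure (v.adicCompletion K))) :
    Function.Bijective (fun y : {y : AlgPoints T (AlgebraicClosure (v.adicCompletion K)) // AlgPoints.map p y = x} =>
      (⟨extendPoint (closureValuationSubring (v.adicCompletion K)) (toClosureValuationSubring v) 𝒯.total (𝒯.modelPointsEquiv.symm y.1),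
        by rw [extendPoint_symm_comp 𝒮 𝒯 π p hπp, y.2]⟩ :
        {ρ : specValuationSubring (closureValuationSubring (v.adicCompletion K)) (toClosureValuationSubring v) ⟶ 𝒯.total //
          ρ ≫ π = extendPoint (closureValuationSubring (v.adicCompletion K)) (toClosureValuationSubring v) 𝒮.total
            (𝒮.modelPointsEquiv.symm x)})) := by
  constructor
  · rintro ⟨y, hy⟩ ⟨y', hy'⟩ h
    have h' := congrArg Subtype.val h
    dsimp only at h'
    have h'' := congrArg (restrictPoint (closureValuationSubring (v.adicCompletion K)) (toClosureValuationSubring v) 𝒯.total) h'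
    rw [restrictPoint_extendPoint, restrictPoint_extendPoint] at h''
    exact Subtype.ext (𝒯.modelPointsEquiv.symm.injective h'')
  · rintro ⟨ρ, hρ⟩
    refine ⟨⟨𝒯.modelPointsEquiv (restrictPoint (closureValuationSubring (v.adicCompletion K)) (toClosureValuationSubring v) 𝒯.total ρ), ?_⟩, ?_⟩
    · rw [← modelPointsEquiv_comp 𝒯 𝒮 π p hπp, ← restrictPoint_comp, hρ, restrictPoint_extendPoint, Equiv.apply_symm_apply]
    · apply Subtype.ext
      dsimp only
      rw [Equiv.symm_apply_apply, extendPoint_restrictPoint]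

/-- Under the bijection, **the reduction of `y` is the specialisation of its integral extension**: `red_𝒯 y = reductionPoint (ι_κ ≫ ỹ)`
(★ `geomReductionMap_def`). [cite: SerreTate1968, §1] -/
theorem geomReductionMap_eq_reductionPoint_extendPoint (𝒯 : IntegralModel (valuationSubringAtPrime K v) K T) [IsProper 𝒯.total.hom]
    (y : AlgPoints T (AlgebraicClosure (v.adicCompletion K))) :
    𝒯.geomReductionMap y = 𝒯.reductionPoint
      (specRingHomι (closureValuationSubring (v.adicCompletion K)) (toClosureValuationSubring v)
          (IsLocalRing.residue (closureValuationSubring (v.adicCompletion K))) ≫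
        extendPoint (closureValuationSubring (v.adicCompletion K)) (toClosureValuationSubring v) 𝒯.total (𝒯.modelPointsEquiv.symm y)) :=
  rfl

/-- … and for an integral point `ρ` over `x̃`, the generic point `y := e_𝒯 (ρ|_{Spec Ω})` lies over `x` and `red_𝒯 y = reductionPoint (ι_κ ≫ ρ)`
(★ `geomReductionMap_modelPointsEquiv_restrictPoint`). [cite: SerreTate1968, §1] -/
theorem map_modelPointsEquiv_restrictPoint_eq (𝒮 : IntegralModel (valuationSubringAtPrime K v) K X)
    (𝒯 : IntegralModel (valuationSubringAtPrime K v) K T) [IsProper 𝒮.total.hom] [IsProper 𝒯.total.hom]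
    (π : 𝒯.total ⟶ 𝒮.total) (p : T ⟶ X)
    (hπp : (genericFibre (valuationSubringAtPrime K v) K).map π ≫ 𝒮.genericIso'.hom = 𝒯.genericIso'.hom ≫ p)
    (x : AlgPoints X (AlgebraicClosure (v.adicCompletion K)))
    (ρ : specValuationSubring (closureValuationSubring (v.adicCompletion K)) (toClosureValuationSubring v) ⟶ 𝒯.total)
    (hρ : ρ ≫ π = extendPoint (closureValuationSubring (v.adicCompletion K)) (toClosureValuationSubring v) 𝒮.total (𝒮.modelPointsEquiv.symm x)) :
    AlgPoints.map p (𝒯.modelPointsEquiv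
      (restrictPoint (closureValuationSubring (v.adicCompletion K)) (toClosureValuationSubring v) 𝒯.total ρ)) = x := by
  rw [← modelPointsEquiv_comp 𝒯 𝒮 π p hπp, ← restrictPoint_comp, hρ, restrictPoint_extendPoint, Equiv.apply_symm_apply]

/-- **The reduction of a point of the generic fibre over `x` lies over `red_𝒮 x`** (★ C2a `geomReductionMap_map`). [cite: SerreTate1968, §1] -/
theorem map_geomReductionMap_of_map_eq (𝒮 : IntegralModel (valuationSubringAtPrime K v) K X)
    (𝒯 : IntegralModel (valuationSubringAtPrime K v) K T) [IsProper 𝒮.total.hom] [IsProper 𝒯.total.hom]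
    (π : 𝒯.total ⟶ 𝒮.total) (p : T ⟶ X)
    (hπp : (genericFibre (valuationSubringAtPrime K v) K).map π ≫ 𝒮.genericIso'.hom = 𝒯.genericIso'.hom ≫ p)
    (x : AlgPoints X (AlgebraicClosure (v.adicCompletion K))) (y : AlgPoints T (AlgebraicClosure (v.adicCompletion K)))
    (hy : AlgPoints.map p y = x) :
    AlgPoints.map ((specialFibreFunctor v).map π) (𝒯.geomReductionMap y) = 𝒮.geomReductionMap x := by
  rw [← hy, geomReductionMap_map 𝒯 𝒮 π p hπp]

/-- **Counting over `x` is counting integral points over `x̃`**: for every `κ̄(v)`-point `ȳ` of `𝒯_v`, the points `y ∈ T(Ω)` over `x` with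
`red_𝒯 y = ȳ` are in bijection (by `y ↦ ỹ`) with the `R`-points `ρ` of `𝒯` over `x̃` with `reductionPoint (ι_κ ≫ ρ) = ȳ`; in particular the two
sets have the same cardinality. [cite: SerreTate1968, §1] [cite: Liu2002, §10.1.3] -/
theorem ncard_fibre_geomReductionMap_eq (𝒮 : IntegralModel (valuationSubringAtPrime K v) K X)
    (𝒯 : IntegralModel (valuationSubringAtPrime K v) K T) [IsProper 𝒮.total.hom] [IsProper 𝒯.total.hom]
    (π : 𝒯.total ⟶ 𝒮.total) (p : T ⟶ X)
    (hπp : (genericFibre (valuationSubringAtPrime K v) K).map π ≫ 𝒮.genericIso'.hom = 𝒯.genericIso'.hom ≫ p)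
    (x : AlgPoints X (AlgebraicClosure (v.adicCompletion K))) (z : AlgPoints 𝒯.reductionAt (geomResidueField v)) :
    Set.ncard {y : AlgPoints T (AlgebraicClosure (v.adicCompletion K)) | AlgPoints.map p y = x ∧ 𝒯.geomReductionMap y = z} =
      Set.ncard {ρ : specValuationSubring (closureValuationSubring (v.adicCompletion K)) (toClosureValuationSubring v) ⟶ 𝒯.total |
          ρ ≫ π = extendPoint (closureValuationSubring (v.adicCompletion K)) (toClosureValuationSubring v) 𝒮.total (𝒮.modelPointsEquiv.symm x) ∧
          𝒯.reductionPoint (specRingHomι (closureValuationSubring (v.adicCompletion K)) (toClosureValuationSubring v)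
            (IsLocalRing.residue (closureValuationSubring (v.adicCompletion K))) ≫ ρ) = z} := by
  refine Set.ncard_congr (fun y _ =>
    extendPoint (closureValuationSubring (v.adicCompletion K)) (toClosureValuationSubring v) 𝒯.total (𝒯.modelPointsEquiv.symm y))
    (fun y hy => ?_) (fun y y' _ _ h => ?_) (fun ρ hρ => ?_)
  · refine ⟨by rw [extendPoint_symm_comp 𝒮 𝒯 π p hπp, hy.1], ?_⟩
    rw [← geomReductionMap_eq_reductionPoint_extendPoint]; exact hy.2
  · have h' := congrArg (restrictPoint (closureValuationSubring (v.adicCompletion K)) (toClosureValuationSubring v) 𝒯.total) h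
    rw [restrictPoint_extendPoint, restrictPoint_extendPoint] at h'
    exact 𝒯.modelPointsEquiv.symm.injective h'
  · refine ⟨𝒯.modelPointsEquiv (restrictPoint (closureValuationSubring (v.adicCompletion K)) (toClosureValuationSubring v) 𝒯.total ρ),
      ⟨map_modelPointsEquiv_restrictPoint_eq 𝒮 𝒯 π p hπp x ρ hρ.1, ?_⟩, ?_⟩
    · rw [geomReductionMap_modelPointsEquiv_restrictPoint]; exact hρ.2
    · rw [Equiv.symm_apply_apply, extendPoint_restrictPoint]

end IntegralModel

end Literature.AlgebraicGeometry.Motives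

end
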